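import Mathlib
import Summits.MatrixMultiplication.MatrixMultiplication.Theses.FieldSumsetRank

/-!
# MatrixMultiplication / FieldSumsetRank — `StrassenHostingEleven`

Route `FieldSumsetRank`, support item `stmt-MatrixMultiplication-8740`: the `2 × 2` matrix
multiplication map `⟨2,2,2⟩` has a *polynomial hosting* of cost `≤ 11`, i.e. there are `ℂ`-linear
maps `α β : M₂(ℂ) → ℂ[t]` and `γ : ℂ[t] → M₂(ℂ)` with `γ (α X * β Y) = X * Y` for all `X, Y` and
`dim (range α * range β) ≤ 11`.

We land the explicit hosting of cost `≤ 9` found in the route review (refuter evidence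
`HostingNine.lean` on the item), which proves the item a fortiori:

* `α X = X₀₀ + X₀₁ t + X₁₀ t² + X₁₁ t³`,
* `β Y = Y₁₀ + Y₀₀ t + Y₁₁ t⁴ + Y₀₁ t⁵`,
* `γ f = [[f₁, f₅], [f₃, f₇]]` (four odd coefficients of `f`).

The coefficients of `t`, `t⁵`, `t³`, `t⁷` in `α X * β Y` are exactly `(XY)₀₀`, `(XY)₀₁`, `(XY)₁₀`,
`(XY)₁₁` (each of the eight other cross terms `X_{ij} Y_{kl}`, `j ≠ k`, lands on an even power of
`t`), and
`range α * range β ⊆ ℂ[t]_{<9}`, a space of dimension `9 ≤ 11`.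

Design: the three witnesses are assembled inline from Mathlib's `Polynomial.monomial`,
`Matrix.entryLinearMap`, `Polynomial.lcoeff`, `LinearMap.smulRight` and `Matrix.single`; the file
introduces no definition. Deliberately NOT here: the Strassen/GRS₆ hosting of cost `11` described
in the item text (superseded by the cheaper witness) and any lower bound on the cost.
-/

-- `Summit.<Summit>.<Problem>.Theorems` repeats `MatrixMultiplication` by the D-0017 layout (Sub = Summit).
set_option linter.dupNamespace false

namespace Summit.MatrixMultiplication.MatrixMultiplication.Theorems

open Polynomial

/-- The space `ℂ[t]_{<n}` of polynomials of degree `< n` has dimension `n` (via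
`Polynomial.degreeLTEquiv`). [folklore] -/
theorem strassenHostingEleven_finrank_degreeLT (n : ℕ) :
    Module.finrank ℂ ↥(Polynomial.degreeLT ℂ n) = n := by
  rw [LinearEquiv.finrank_eq (Polynomial.degreeLTEquiv ℂ n), Module.finrank_fin_fun]

/-- Settles `stmt-MatrixMultiplication-8740` (`StrassenHostingEleven`), exact signature: `⟨2,2,2⟩`
has a polynomial hosting of cost `≤ 11` — witnessed by the cost-`9` hosting
`α X = X₀₀ + X₀₁ t + X₁₀ t² + X₁₁ t³`, `β Y = Y₁₀ + Y₀₀ t + Y₁₁ t⁴ + Y₀₁ t⁵`,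
`γ f = [[f₁, f₅], [f₃, f₇]]`, whose product space lies in `ℂ[t]_{<9}`. [folklore] -/
theorem strassenHostingEleven_proof :
    Summit.MatrixMultiplication.MatrixMultiplication.Theses.FieldSumsetRank.StrassenHostingEleven := by
  unfold Summit.MatrixMultiplication.MatrixMultiplication.Theses.FieldSumsetRank.StrassenHostingEleven
  -- entry functionals `X ↦ X i j`
  let e : Fin 2 → Fin 2 → (Matrix (Fin 2) (Fin 2) ℂ →ₗ[ℂ] ℂ) :=
    fun i j => Matrix.entryLinearMap ℂ ℂ i j
  -- the three witnesses
  let α : Matrix (Fin 2) (Fin 2) ℂ →ₗ[ℂ] ℂ[X] :=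
    (monomial 0).comp (e 0 0) + (monomial 1).comp (e 0 1) + (monomial 2).comp (e 1 0)
      + (monomial 3).comp (e 1 1)
  let β : Matrix (Fin 2) (Fin 2) ℂ →ₗ[ℂ] ℂ[X] :=
    (monomial 1).comp (e 0 0) + (monomial 5).comp (e 0 1) + (monomial 0).comp (e 1 0)
      + (monomial 4).comp (e 1 1)
  let γ : ℂ[X] →ₗ[ℂ] Matrix (Fin 2) (Fin 2) ℂ :=
    (lcoeff ℂ 1).smulRight (Matrix.single 0 0 1) + (lcoeff ℂ 5).smulRight (Matrix.single 0 1 1)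
      + (lcoeff ℂ 3).smulRight (Matrix.single 1 0 1) + (lcoeff ℂ 7).smulRight (Matrix.single 1 1 1)
  have hα : ∀ X : Matrix (Fin 2) (Fin 2) ℂ, α X =
      monomial 0 (X 0 0) + monomial 1 (X 0 1) + monomial 2 (X 1 0) + monomial 3 (X 1 1) :=
    fun X => rfl
  have hβ : ∀ Y : Matrix (Fin 2) (Fin 2) ℂ, β Y =
      monomial 1 (Y 0 0) + monomial 5 (Y 0 1) + monomial 0 (Y 1 0) + monomial 4 (Y 1 1) :=
    fun Y => rfl
  have hγ : ∀ f : ℂ[X], γ f =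
      f.coeff 1 • Matrix.single (0 : Fin 2) (0 : Fin 2) (1 : ℂ) + f.coeff 5 • Matrix.single 0 1 1
        + f.coeff 3 • Matrix.single 1 0 1 + f.coeff 7 • Matrix.single 1 1 1 :=
    fun f => rfl
  refine ⟨α, β, γ, ?_, ?_⟩
  · -- the hosting identity `γ (α X * β Y) = X * Y`, checked entrywise on coefficients
    intro X Y
    rw [hγ, hα, hβ]
    ext i j
    fin_cases i <;> fin_cases j <;>
      simp [mul_add, add_mul, monomial_mul_monomial, coeff_monomial, Matrix.mul_apply,
        Fin.sum_univ_two, Matrix.single]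
  · -- the cost bound: `range α * range β ≤ ℂ[t]_{<9}`, of dimension `9 ≤ 11`
    have hdegα : ∀ X : Matrix (Fin 2) (Fin 2) ℂ, (α X).natDegree ≤ 3 := by
      intro X
      rw [hα]
      refine natDegree_add_le_of_degree_le (natDegree_add_le_of_degree_le
        (natDegree_add_le_of_degree_le ?_ ?_) ?_) ?_
      all_goals exact (natDegree_monomial_le _).trans (by norm_num)
    have hdegβ : ∀ Y : Matrix (Fin 2) (Fin 2) ℂ, (β Y).natDegree ≤ 5 := by
      intro Y
      rw [hβ]
      refine natDegree_add_le_of_degree_le (natDegree_add_le_of_degree_le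
        (natDegree_add_le_of_degree_le ?_ ?_) ?_) ?_
      all_goals exact (natDegree_monomial_le _).trans (by norm_num)
    have hle : LinearMap.range α * LinearMap.range β ≤ degreeLT ℂ 9 := by
      rw [Submodule.mul_le]
      rintro _ ⟨X, rfl⟩ _ ⟨Y, rfl⟩
      rw [mem_degreeLT]
      have h8 : (α X * β Y).natDegree ≤ 8 :=
        natDegree_mul_le.trans (by have := hdegα X; have := hdegβ Y; omega)
      exact (natDegree_le_iff_degree_le.mp h8).trans_lt (by exact_mod_cast (by norm_num : (8 : ℕ) < 9))
    haveI : Module.Finite ℂ ↥(degreeLT ℂ 9) := Module.Finite.equiv (degreeLTEquiv ℂ 9).symm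
    calc Module.finrank ℂ ↥(LinearMap.range α * LinearMap.range β)
        ≤ Module.finrank ℂ ↥(degreeLT ℂ 9) := Submodule.finrank_mono hle
      _ = 9 := strassenHostingEleven_finrank_degreeLT 9
      _ ≤ 11 := by norm_num

end Summit.MatrixMultiplication.MatrixMultiplication.Theorems
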